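import Literature.NumberTheory.ComplexMultiplication.CMAlgebraLatticeOrderExtensionKernel
import HarnessLib

/-!
# `(Λ_1/C)^{unit}/(Λ_2/C)^{unit} ≅ ker(G(Λ_2) → G(Λ_1))`, `a ↦ C + aΛ_2`, for orders `Λ_2 ⊆ Λ_1` of a CM-ALGEBRA
# `Y = L_1 ⊕ ⋯ ⊕ L_t` with conductor `C = Λ_2:Λ_1` (Hertling–Larabi 2026 Thm. 8.2 (d)) — surjectivity and fibres,
# def-free; with the Chinese remainder theorem `Λ_1 → ∏_{p∈P_0} (Λ_1)_(p)/C_(p)` (Thm. 7.6 (a))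

[node N13c] [stratum S1] [book HertlingLarabi2026 > §7 Localization > Thm. 7.6 (a); §8 > Thm. 8.2 (d)]

Topic `Literature/NumberTheory/ComplexMultiplication`, namespace `Literature.NumberTheory.ComplexMultiplication`;
lane `lit-hodgefound` (Track 2 foundations library), Layer A3, seat p19 generation 32, row g32-#7 — sequel of
g32-#5 (`CMAlgebraLatticeOrderExtensionKernel`: Thm. 7.6 (b); the kernel criterion
`order_mul_eq_iff_forall_prime_exists_localUnit_locEq`; Thm. 8.2 (d) WELL-DEFINEDNESS
`conductor_sup_map_mulLeft_mem_ker`: `C + aΛ_2 ∈ ker` for `a + C ∈ (Λ_1/C)^{unit}`).  This file adds the other two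
thirds of the bijection (8.6): SURJECTIVITY (every `K ∈ G(Λ_2)` with `Λ_1K = Λ_1` is `C + aΛ_2` with
`a + C ∈ (Λ_1/C)^{unit}`) and the FIBRES (`C + aΛ_2 = C + bΛ_2` iff `b ∈ a(Λ_2/C)^{unit}` mod `C`).  THEOREMS ONLY:
no definition, no instance, no named fact (D-0026, net Literature debt `0`), no `sorry`.

DEF-FREE SPELLING (continued).  `C + aΛ_2` = `Λ_2/Λ_1 ⊔ Λ_2.map (LinearMap.mulLeft ℤ a)`; «`a + C ∈ (Λ_1/C)^{unit}`»
= `∃ a' ∈ Λ_1, a·a' − 1 ∈ C`; «`x ≡ y (mod C_(p))`» = `∃ s : ℤ, ¬ ↑p ∣ s ∧ s·(x − y) ∈ C`.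

## Source, VERBATIM

C. Hertling, K. Larabi, *Semigroups from full lattices in commutative ℚ-algebras*, arXiv:2602.14973 (2026)
[HertlingLarabi2026], held `paper:arxiv-2602.14973`.  §7 (chunk p0019): «**Theorem 7.6.** Let `A` be as in Theorem
3.1. Let `Λ` be an order, and let `L ⊂ Λ` be a `Λ`-ideal (not necessarily exact). The set
`P_0 := {p ∈ ℙ | Λ_(p) ≠ L_(p)}` is finite by Theorem 7.2 (b). (a) The quotient `Λ/L` is a finite commutative ring
with unit element. […] There is a natural isomorphism `Λ/L → ∏_{p∈P_0} Λ_(p)/L_(p)` of finite commutative rings with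
unit elements.»  §8 (chunks p0021–p0022): «**Theorem 8.2.** Let `Λ_1` and `Λ_2` be two orders in `A` with
`Λ_2 ⊊ Λ_1`. The full lattice `C := Λ_2:Λ_1` is called conductor of the pair `(Λ_1, Λ_2)`. […] (d) The isomorphism
of groups `(Λ_1/C)^{unit}/(Λ_2/C)^{unit} → ker(G(Λ_2) → G(Λ_1))` which results from (b) and (c) is given by
`((a + C) mod (Λ_2/C)^{unit}) ↦ C + aΛ_2`, where `a ∈ Λ_1`, `a + C ∈ (Λ_1/C)^{unit} ⊂ Λ_1/C`. […] *Proof:* […]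
(d) Consider `a ∈ Λ_1` with `a + C ∈ (Λ_1/C)^{unit}`. We claim `(a + C)Λ_1 = Λ_1`. […] By the proof of Theorem 7.6
(b) for each `p ∈ P_0` an element `d_p ∈ a + C ⊂ Λ_1` with `d_p ∈ (Λ_1)_(p)^{unit}` exists. By the proof of part
(c), the image in `⊕_{p∈P_0}(Λ_1)_(p)^{unit}/(Λ_2)_(p)^{unit}` of the class `((a + C) mod (Λ_2/C)^{unit})` under the
isomorphism in (8.4) is the class of the tuple `(d_p)_{p∈P_0}`. Define `d_p := 1_A` for `p ∈ ℙ − P_0`. By part (b)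
the image of `(d_p)_{p∈P_0}` in `ker(G(Λ_2) → G(Λ_1))` is the full lattice `L = ⋂_{p∈P_0} d_p(Λ_2)_(p)`. It remains
to show `L = C + aΛ_2`. […] Therefore `L = ⋂_{p∈ℙ}(C + aΛ_2)_(p) = C + aΛ_2`. This shows part (d).»

HL obtain the bijectivity of (8.6) from the exact sequence (b) and the isomorphism (c) (which rests on Thm.
7.6 (a), (b)).  Here, def-free: SURJECTIVITY — for `K ∈ ker` take its local generators `u_p ∈ K ∩ (Λ_1)_(p)^{unit}`
(Thm. 7.3, g32-#4), glue `a ∈ Λ_1` with `a ≡ u_p (mod C_(p))` for the finitely many `p` with `(Λ_1)_(p) ≠ (Λ_2)_(p)`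
(Chinese remainder theorem in the ring `Λ_1` for the pairwise coprime ideals `Λ_1 ∩ C_(p)`, §1), and compare
`C + aΛ_2` with `K` prime by prime (`C ⊆ K`; at `p ∈ P_0` both agree with `u_pΛ_2`, elsewhere both agree with
`Λ_1`); FIBRES — elementwise.

## Contents

* §1 `exists_mem_forall_locEq_sub` — THEOREM 7.6 (a), surjectivity part: for an order `Λ`, a `Λ`-ideal `C ⊆ Λ`
  with `NΛ ⊆ C` (`N ≠ 0`), finitely many primes `p` and targets `c_p ∈ Λ`, some `a ∈ Λ` has `a ≡ c_p (mod C_(p))`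
  for all of them.
* §2 `exists_eq_conductor_sup_map_mulLeft` — THEOREM 8.2 (d), SURJECTIVITY of (8.6): every `K ∈ G(Λ_2)` with
  `Λ_1K = Λ_1` equals `C + aΛ_2` for some `a ∈ Λ_1` with `a + C ∈ (Λ_1/C)^{unit}`; with `conductor_le_of_order_mul_eq` (`C ⊆ K`).
* §3 `conductor_sup_map_mulLeft_eq_iff` — THEOREM 8.2 (d), FIBRES of (8.6): `C + aΛ_2 = C + bΛ_2` iff
  `b − av ∈ C` for some `v ∈ Λ_2` with `v + C ∈ (Λ_2/C)^{unit}`.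

## References

* [HL26] C. Hertling, K. Larabi, *Semigroups from full lattices in commutative ℚ-algebras*, arXiv:2602.14973
  (2026), §7 Thm. 7.6 (a) (chunk p0019), §8 Thm. 8.2 (c), (d) (chunks p0021–p0022). [cite: HertlingLarabi2026]
* [Ne99] J. Neukirch, *Algebraic Number Theory*, Grundlehren 322 (1999), I §12 Prop. (12.9), (12.11) (one field:
  `(𝒪_K/𝔣)^*/(𝒪/𝔣)^* ≅ ⊕_𝔭 𝒪_{K,𝔭}^*/𝒪_𝔭^* → Pic(𝒪)`), identified with Thm. 8.2 (c), (e) in [HL26] Rem. 8.3.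
  [cite: NeukirchANT1999]
* [Fa65] D. K. Faddeev, Trudy Mat. Inst. Steklov 80 (1965) 145–182, as cited by [HL26] §7. [cite: Faddeev1965]
-/

noncomputable section

open scoped Classical Pointwise nonZeroDivisors NumberField
open Module NumberField Function

namespace Literature.NumberTheory.ComplexMultiplication

open Literature.NumberTheory.Automorphic

section ConductorKernel

variable {t : Type} {L : t → Type} [∀ i, Field (L i)] [∀ i, NumberField (L i)]

/-! ## §1 Theorem 7.6 (a): the Chinese remainder theorem `Λ → ∏_{p∈P_0} Λ_(p)/C_(p)` -/

omit [∀ i, NumberField (L i)] in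
/-- **THEOREM 7.6 (a), surjectivity of `Λ → ∏_{p∈P_0} Λ_(p)/L_(p)`: for an order `Λ ⊂ Y`, a `Λ`-ideal `C ⊆ Λ` with
`NΛ ⊆ C` for some integer `N ≠ 0`, a finite set `P_0` of primes and elements `c_p ∈ Λ` (`p ∈ P_0`), there is
`a ∈ Λ` with `a ≡ c_p (mod C_(p))` — `s_p(a − c_p) ∈ C`, `p ∤ s_p` — for every `p ∈ P_0`.**  Chinese remainder theorem
in the ring `Λ` for the ideals `I_p = {x ∈ Λ | sx ∈ C for some s prime to p}`, pairwise coprime because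
`N = p^e m = q^f m'` (`p ∤ m`, `q ∤ m'`) and `up^e + vq^f = 1` give `up^e·1 ∈ I_p`, `vq^f·1 ∈ I_q`.
[cite: HertlingLarabi2026, §7 Thm. 7.6 (a) («There is a natural isomorphism Λ/L → ∏_{p∈P_0} Λ_(p)/L_(p)»), chunk p0019] -/
theorem exists_mem_forall_locEq_sub {Λ C : Submodule ℤ (Π i, L i)} (h1 : (1 : Π i, L i) ∈ Λ)
    (hΛΛ : Λ * Λ ≤ Λ) (hΛC : Λ * C ≤ C) {N : ℤ} (hN : N ≠ 0) (hNC : ∀ x ∈ Λ, N • x ∈ C)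
    (P₀ : Finset ℕ) (hP₀ : ∀ p ∈ P₀, p.Prime) {c : ℕ → Π i, L i} (hc : ∀ p ∈ P₀, c p ∈ Λ) :
    ∃ a ∈ Λ, ∀ p ∈ P₀, ∃ s : ℤ, ¬ (p : ℤ) ∣ s ∧ s • (a - c p) ∈ C := by
  classical
  -- the commutative ring `S = Λ`
  let S : Subring (Π i, L i) :=
    { carrier := ((Λ : Submodule ℤ (Π i, L i)) : Set (Π i, L i))
      mul_mem' := fun ha hb => hΛΛ (Submodule.mul_mem_mul ha hb)
      one_mem' := h1
      add_mem' := fun ha hb => Λ.add_mem ha hb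
      zero_mem' := Λ.zero_mem
      neg_mem' := fun ha => Λ.neg_mem ha }
  have hprime : ∀ p : P₀, Prime ((p : ℕ) : ℤ) := fun p => Nat.prime_iff_prime_int.1 (hP₀ p p.2)
  -- the ideals `I_p = Λ ∩ C_(p)`
  let I : P₀ → Ideal S := fun p =>
    { carrier := {x | ∃ s : ℤ, ¬ ((p : ℕ) : ℤ) ∣ s ∧ s • (x : Π i, L i) ∈ C}
      add_mem' := fun {x y} ⟨s, hs, hx⟩ ⟨s', hs', hy⟩ =>
        ⟨s * s', fun h => ((hprime p).dvd_or_dvd h).elim hs hs', by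
          rw [Subring.coe_add, smul_add]
          exact C.add_mem (by rw [mul_comm, mul_smul]; exact C.smul_mem _ hx)
            (by rw [mul_smul]; exact C.smul_mem _ hy)⟩
      zero_mem' := ⟨1, fun h => (hP₀ p p.2).ne_one (by exact_mod_cast Int.eq_one_of_dvd_one (by positivity) h),
        by simp⟩
      smul_mem' := fun r {x} ⟨s, hs, hx⟩ => ⟨s, hs, by
        rw [smul_eq_mul, Subring.coe_mul, ← mul_smul_comm]
        exact hΛC (Submodule.mul_mem_mul r.2 hx)⟩ }
  have hI : ∀ (p : P₀) (x : S), x ∈ I p ↔ ∃ s : ℤ, ¬ ((p : ℕ) : ℤ) ∣ s ∧ s • (x : Π i, L i) ∈ C :=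
    fun p x => Iff.rfl
  -- `|N|·1 ∈ C`
  have hN1 : ((N.natAbs : ℤ)) • (1 : Π i, L i) ∈ C := by
    rcases Int.natAbs_eq N with h | h
    · rw [← h]; exact hNC 1 h1
    · have h' : (N.natAbs : ℤ) = -N := by omega
      rw [h', neg_smul]; exact C.neg_mem (hNC 1 h1)
  -- pairwise coprime
  have hcop : Pairwise (IsCoprime on I) := by
    intro p q hpq
    have hpq' : (p : ℕ) ≠ (q : ℕ) := fun h => hpq (Subtype.ext h)
    obtain ⟨e, m, hm, hNm⟩ := Nat.exists_eq_pow_mul_and_not_dvd (Int.natAbs_ne_zero.2 hN) p (hP₀ p p.2).ne_one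
    obtain ⟨f, m', hm', hNm'⟩ := Nat.exists_eq_pow_mul_and_not_dvd (Int.natAbs_ne_zero.2 hN) q (hP₀ q q.2).ne_one
    obtain ⟨u, v, huv⟩ := (Nat.coprime_pow_primes e f (hP₀ p p.2) (hP₀ q q.2) hpq').isCoprime
    refine (Ideal.isCoprime_iff_exists).2 ⟨((u * (p : ℕ) ^ e : ℤ) : S), ?_, ((v * (q : ℕ) ^ f : ℤ) : S), ?_, ?_⟩
    · refine (hI p _).2 ⟨m, fun h => hm (Int.natCast_dvd_natCast.1 h), ?_⟩
      rw [SubringClass.coe_intCast, ← Int.smul_one_eq_cast, ← mul_smul]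
      have e1 : (m : ℤ) * (u * (p : ℕ) ^ e) = u * (N.natAbs : ℤ) := by rw [hNm]; push_cast; ring
      rw [e1, mul_smul]
      exact C.smul_mem u hN1
    · refine (hI q _).2 ⟨m', fun h => hm' (Int.natCast_dvd_natCast.1 h), ?_⟩
      rw [SubringClass.coe_intCast, ← Int.smul_one_eq_cast, ← mul_smul]
      have e1 : (m' : ℤ) * (v * (q : ℕ) ^ f) = v * (N.natAbs : ℤ) := by rw [hNm']; push_cast; ring
      rw [e1, mul_smul]
      exact C.smul_mem v hN1
    · have h := congrArg (fun z : ℤ => (z : S)) huv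
      push_cast at h ⊢
      exact h
  -- Chinese remainder theorem
  obtain ⟨r, hr⟩ := Ideal.pi_quotient_surjective hcop fun p => Ideal.Quotient.mk (I p) ⟨c p, hc p p.2⟩
  refine ⟨r, r.2, fun p hp => ?_⟩
  have h := (Ideal.Quotient.eq).1 (hr ⟨p, hp⟩)
  exact (hI ⟨p, hp⟩ _).1 h

/-! ## §2 Theorem 8.2 (d), surjectivity: every `K ∈ ker(G(Λ_2) → G(Λ_1))` is `C + aΛ_2` -/

omit [∀ i, NumberField (L i)] in
/-- `aΛ_2`, written `Λ_2.map (mulLeft a)`, is `a • Λ_2` when `a` is a unit of `Y`. [folklore] -/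
private theorem map_mulLeft_eq_units_smul' (a : (Π i, L i)ˣ) (M : Submodule ℤ (Π i, L i)) :
    M.map (LinearMap.mulLeft ℤ (a : Π i, L i)) = a • M := by
  ext x
  rw [Submodule.mem_map, Units.smul_def, Submodule.mem_smul_pointwise_iff_exists]
  simp only [LinearMap.mulLeft_apply, smul_eq_mul]

/-- **THEOREM 8.2 (b)–(d): the conductor lies in every member of the kernel — `C = Λ_2:Λ_1 ⊆ K` for `K ∈ G(Λ_2)`
with `Λ_1K = Λ_1`** (locally `C_(p) = u_pC_(p) ⊆ u_p(Λ_2)_(p) = K_(p)` for the local generators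
`u_p ∈ (Λ_1)_(p)^{unit}` of `K`, Thm. 7.3; then Thm. 7.2 (a)). [cite: HertlingLarabi2026, §8 Thm. 8.2 (b) Step 3 and (d) proof («C_(p) + d_p(Λ_2)_(p) = d_pC_(p) + d_p(Λ_2)_(p)»), chunk p0022] -/
theorem conductor_le_of_order_mul_eq {Λ₁ Λ₂ K : Submodule ℤ (Π i, L i)} (h1 : (1 : Π i, L i) ∈ Λ₁)
    (hΛ₁Λ₁ : Λ₁ * Λ₁ ≤ Λ₁) (h2 : (1 : Π i, L i) ∈ Λ₂) (hle : Λ₂ ≤ Λ₁) (hK : IsFullLattice (Π i, L i) K)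
    (hKO : K / K = Λ₂) (hKinv : K * ((K / K) / K) = K / K) (hker : Λ₁ * K = Λ₁) : Λ₂ / Λ₁ ≤ K := by
  intro x hx
  refine mem_of_forall_prime_exists_not_dvd_smul_mem fun p hp => ?_
  have hp' : Prime (p : ℤ) := Nat.prime_iff_prime_int.1 hp
  obtain ⟨u, huΛ₁, ⟨b, hb, r, hr, hub⟩, hloc⟩ :=
    (order_mul_eq_iff_forall_prime_exists_localUnit_locEq h1 hΛ₁Λ₁ h2 hle hK hKO hKinv).1 hker p hp
  have hΛ₁loc := locEq_units_smul_of_mul_eq_smul_one hΛ₁Λ₁ huΛ₁ hb hr hub (Units.isUnit u)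
  have hu : (Units.isUnit u).unit = u := Units.ext (IsUnit.unit_spec _)
  rw [hu] at hΛ₁loc
  have hΛ₁C : Λ₁ * (Λ₂ / Λ₁) = Λ₂ / Λ₁ :=
    le_antisymm (conductor_mul_le h1 hΛ₁Λ₁) fun y hy => by rw [← one_mul y]; exact Submodule.mul_mem_mul h1 hy
  have hC := locEq_mul hp hΛ₁loc (locEq_refl hp (Λ₂ / Λ₁))
  rw [← units_smul_mul, hΛ₁C] at hC
  obtain ⟨s, hs, hsC, -⟩ := hC
  obtain ⟨s', hs', -, hs'K⟩ := hloc
  refine ⟨s' * s, fun h => (hp'.dvd_or_dvd h).elim hs' hs, ?_⟩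
  rw [mul_smul]
  refine hs'K _ ?_
  have h := hsC x hx
  rw [mem_units_smul_submodule_iff] at h ⊢
  exact conductor_le h1 h

/-- **THEOREM 8.2 (d), SURJECTIVITY of (8.6) `(Λ_1/C)^{unit}/(Λ_2/C)^{unit} → ker(G(Λ_2) → G(Λ_1))`: for orders
`Λ_2 ⊆ Λ_1` of `Y` with conductor `C = Λ_2:Λ_1`, every `K ∈ G(Λ_2)` (full, exact order `Λ_2`, invertible) with
`Λ_1K = Λ_1` is `K = C + aΛ_2` for some `a ∈ Λ_1` with `a + C ∈ (Λ_1/C)^{unit}`** («the image … is the full lattice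
`L = ⋂ d_p(Λ_2)_(p)`. It remains to show `L = C + aΛ_2`»: with local generators `u_p ∈ K ∩ (Λ_1)_(p)^{unit}` (Thm. 7.3)
choose `a ≡ u_p (mod C_(p))` for the finitely many `p` with `(Λ_1)_(p) ≠ (Λ_2)_(p)` by §1; at those `p` both `K_(p)`
and `(C + aΛ_2)_(p) = (C + u_pΛ_2)_(p)` are `u_p(Λ_2)_(p)`, at the others both are `(Λ_1)_(p)` since `C ⊆ K` and
`C_(p) = (Λ_1)_(p)`; finally `1 ∈ Λ_1 = Λ_1K = C + aΛ_1` makes `a + C` a unit).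
[cite: HertlingLarabi2026, §8 Thm. 8.2 (d) (the isomorphism (8.6) «((a+C) mod (Λ_2/C)^unit) ↦ C + aΛ_2», proof), chunks p0021–p0022]
[cite: NeukirchANT1999, I §12 Prop. (12.9), (12.11) (one field), as identified by HertlingLarabi2026 Rem. 8.3] -/
theorem exists_eq_conductor_sup_map_mulLeft {Λ₁ Λ₂ K : Submodule ℤ (Π i, L i)}
    (hΛ₁ : IsFullLattice (Π i, L i) Λ₁) (h1 : (1 : Π i, L i) ∈ Λ₁) (hΛ₁Λ₁ : Λ₁ * Λ₁ ≤ Λ₁)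
    (hΛ₂ : IsFullLattice (Π i, L i) Λ₂) (h2 : (1 : Π i, L i) ∈ Λ₂) (hΛ₂Λ₂ : Λ₂ * Λ₂ ≤ Λ₂) (hle : Λ₂ ≤ Λ₁)
    (hK : IsFullLattice (Π i, L i) K) (hKO : K / K = Λ₂) (hKinv : K * ((K / K) / K) = K / K)
    (hker : Λ₁ * K = Λ₁) :
    ∃ a ∈ Λ₁, (∃ a' ∈ Λ₁, a * a' - 1 ∈ Λ₂ / Λ₁) ∧ K = Λ₂ / Λ₁ ⊔ Λ₂.map (LinearMap.mulLeft ℤ a) := by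
  classical
  have hC : IsFullLattice (Π i, L i) (Λ₂ / Λ₁) := isFullLattice_div hΛ₂ hΛ₁
  have hCΛ₂ : Λ₂ / Λ₁ ≤ Λ₂ := conductor_le h1
  have hΛ₁C : Λ₁ * (Λ₂ / Λ₁) = Λ₂ / Λ₁ :=
    le_antisymm (conductor_mul_le h1 hΛ₁Λ₁) fun y hy => by rw [← one_mul y]; exact Submodule.mul_mem_mul h1 hy
  have hCmul : ∀ c ∈ Λ₂ / Λ₁, ∀ y ∈ Λ₂, c * y ∈ Λ₂ / Λ₁ := fun c hc y hy => by
    rw [mul_comm, ← hΛ₁C]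
    exact Submodule.mul_mem_mul (hle hy) hc
  have hCK : Λ₂ / Λ₁ ≤ K := conductor_le_of_order_mul_eq h1 hΛ₁Λ₁ h2 hle hK hKO hKinv hker
  have hKΛ₁ : K ≤ Λ₁ := fun x hx => by rw [← hker, ← one_mul x]; exact Submodule.mul_mem_mul h1 hx
  -- local generators `u_p ∈ Λ₁ ∩ (Λ₁)_(p)^unit` of `K` at every prime
  have hloc := (order_mul_eq_iff_forall_prime_exists_localUnit_locEq h1 hΛ₁Λ₁ h2 hle hK hKO hKinv).1 hker
  choose u huΛ₁ hunit hKloc using hloc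
  -- `NΛ₁ ⊆ C`; the finitely many primes where `Λ₁` and `Λ₂` differ
  obtain ⟨N, hN, hNC⟩ := exists_smul_mem_of_fg hC hΛ₁.1
  have hF := finite_setOf_prime_not_locEq hΛ₁ hΛ₂
  -- Chinese remainder theorem: `a ≡ u_p (mod C_(p))` there
  obtain ⟨a, haΛ₁, ha⟩ := exists_mem_forall_locEq_sub h1 hΛ₁Λ₁ (conductor_mul_le h1 hΛ₁Λ₁) hN hNC
    hF.toFinset (fun p hp => (hF.mem_toFinset.1 hp).1)
    (c := fun p => if hp : p.Prime then (u p hp : Π i, L i) else 0)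
    (fun p hp => by simp only [dif_pos (hF.mem_toFinset.1 hp).1]; exact huΛ₁ p _)
  have hNΛ₁ : Λ₂ / Λ₁ ⊔ Λ₂.map (LinearMap.mulLeft ℤ a) ≤ Λ₁ := by
    refine sup_le (hCΛ₂.trans hle) ?_
    rintro _ ⟨y, hy, rfl⟩
    rw [LinearMap.mulLeft_apply]
    exact hΛ₁Λ₁ (Submodule.mul_mem_mul haΛ₁ (hle hy))
  -- `K = C + aΛ₂`, prime by prime
  have hKN : K = Λ₂ / Λ₁ ⊔ Λ₂.map (LinearMap.mulLeft ℤ a) := by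
    refine eq_of_forall_prime_locEq fun p hp => ?_
    by_cases hp0 : p ∈ hF.toFinset
    · -- at `p ∈ P₀`: both agree with `u_pΛ₂`
      obtain ⟨s, hs, hsa⟩ := ha p hp0
      simp only [dif_pos hp] at hsa
      have hswap : ∀ {b b' : Π i, L i}, s • (b - b') ∈ Λ₂ / Λ₁ →
          ∀ x ∈ Λ₂ / Λ₁ ⊔ Λ₂.map (LinearMap.mulLeft ℤ b),
            s • x ∈ Λ₂ / Λ₁ ⊔ Λ₂.map (LinearMap.mulLeft ℤ b') := by
        intro b b' hbb' x hx
        obtain ⟨c, hc, _, ⟨y, hy, rfl⟩, rfl⟩ := Submodule.mem_sup.1 hx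
        have e : s • (c + LinearMap.mulLeft ℤ b y) =
            s • c + ((s • (b - b')) * y + LinearMap.mulLeft ℤ b' (s • y)) := by
          simp only [LinearMap.mulLeft_apply, zsmul_eq_mul]
          ring
        rw [e]
        exact Submodule.add_mem _ (Submodule.mem_sup_left ((Λ₂ / Λ₁).smul_mem s hc))
          (Submodule.add_mem _ (Submodule.mem_sup_left (hCmul _ hbb' y hy))
            (Submodule.mem_sup_right ⟨s • y, Λ₂.smul_mem s hy, rfl⟩))
      have hsa' : s • ((u p hp : Π i, L i) - a) ∈ Λ₂ / Λ₁ := by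
        rw [← neg_sub, smul_neg]
        exact (Λ₂ / Λ₁).neg_mem hsa
      have h₁ : ∃ s : ℤ, ¬ (p : ℤ) ∣ s ∧
          (∀ x ∈ Λ₂ / Λ₁ ⊔ Λ₂.map (LinearMap.mulLeft ℤ a), s • x ∈ Λ₂ / Λ₁ ⊔ (u p hp) • Λ₂) ∧
          (∀ x ∈ Λ₂ / Λ₁ ⊔ (u p hp) • Λ₂, s • x ∈ Λ₂ / Λ₁ ⊔ Λ₂.map (LinearMap.mulLeft ℤ a)) := by
        rw [← map_mulLeft_eq_units_smul']
        exact ⟨s, hs, hswap hsa, hswap hsa'⟩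
      -- `(C + u_pΛ₂)_(p) = u_p(Λ₂)_(p)` as `C_(p) = u_pC_(p)`
      obtain ⟨b, hb, r, hr, hub⟩ := hunit p hp
      have hΛ₁loc := locEq_units_smul_of_mul_eq_smul_one hΛ₁Λ₁ (huΛ₁ p hp) hb hr hub (Units.isUnit (u p hp))
      have hu : (Units.isUnit (u p hp)).unit = u p hp := Units.ext (IsUnit.unit_spec _)
      rw [hu] at hΛ₁loc
      have hCloc := locEq_mul hp hΛ₁loc (locEq_refl hp (Λ₂ / Λ₁))
      rw [← units_smul_mul, hΛ₁C] at hCloc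
      have hsup : (u p hp) • (Λ₂ / Λ₁) ⊔ (u p hp) • Λ₂ = (u p hp) • Λ₂ := by
        refine le_antisymm (sup_le (fun x hx => ?_) le_rfl) le_sup_right
        rw [mem_units_smul_submodule_iff] at hx ⊢
        exact hCΛ₂ hx
      have h₂ := locEq_sup hp hCloc (locEq_refl hp ((u p hp) • Λ₂))
      rw [hsup] at h₂
      exact locEq_trans hp (hKloc p hp) (locEq_trans hp (locEq_symm h₂) (locEq_symm h₁))
    · -- at `p ∉ P₀`: `C_(p) = (Λ₁)_(p)`, and `C ⊆ K ⊆ Λ₁`, `C ⊆ C + aΛ₂ ⊆ Λ₁`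
      have hΛ₁₂ : ∃ s : ℤ, ¬ (p : ℤ) ∣ s ∧ (∀ x ∈ Λ₁, s • x ∈ Λ₂) ∧ (∀ x ∈ Λ₂, s • x ∈ Λ₁) := by
        by_contra hne
        exact hp0 (hF.mem_toFinset.2 ⟨hp, hne⟩)
      have hCloc := locEq_div hp (locEq_refl hp Λ₂) hΛ₁₂
      rw [div_self_eq_of_one_mem h2 hΛ₂Λ₂] at hCloc
      obtain ⟨s, hs, -, hsC⟩ := locEq_trans hp hCloc (locEq_symm hΛ₁₂)
      exact ⟨s, hs, fun x hx => Submodule.mem_sup_left (hsC x (hKΛ₁ hx)), fun x hx => hCK (hsC x (hNΛ₁ hx))⟩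
  refine ⟨a, haΛ₁, ?_, hKN⟩
  -- `1 ∈ Λ₁ = Λ₁K = Λ₁(C + aΛ₂) ⊆ C + aΛ₁`
  have h1mem : (1 : Π i, L i) ∈ Λ₁ * (Λ₂ / Λ₁ ⊔ Λ₂.map (LinearMap.mulLeft ℤ a)) := by
    rw [← hKN, hker]; exact h1
  have hle' : Λ₁ * (Λ₂ / Λ₁ ⊔ Λ₂.map (LinearMap.mulLeft ℤ a)) ≤
      Λ₂ / Λ₁ ⊔ Λ₁.map (LinearMap.mulLeft ℤ a) := by
    refine Submodule.mul_le.2 fun x hx z hz => ?_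
    obtain ⟨c, hc, _, ⟨y, hy, rfl⟩, rfl⟩ := Submodule.mem_sup.1 hz
    rw [mul_add, LinearMap.mulLeft_apply]
    refine Submodule.add_mem _ (Submodule.mem_sup_left (conductor_mul_le h1 hΛ₁Λ₁ (Submodule.mul_mem_mul hx hc)))
      (Submodule.mem_sup_right ⟨x * y, hΛ₁Λ₁ (Submodule.mul_mem_mul hx (hle hy)), ?_⟩)
    rw [LinearMap.mulLeft_apply]; ring
  obtain ⟨c, hc, _, ⟨a', ha', rfl⟩, hsum⟩ := Submodule.mem_sup.1 (hle' h1mem)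
  refine ⟨a', ha', ?_⟩
  rw [LinearMap.mulLeft_apply] at hsum
  have e : a * a' - 1 = -c := by linear_combination hsum
  rw [e]
  exact (Λ₂ / Λ₁).neg_mem hc

/-! ## §3 Theorem 8.2 (d), fibres: `C + aΛ_2 = C + bΛ_2` iff `b ∈ a(Λ_2/C)^{unit}` mod `C` -/

omit [∀ i, NumberField (L i)] in
/-- **THEOREM 8.2 (d), the FIBRES of (8.6): for orders `Λ_2 ⊆ Λ_1`, `C = Λ_2:Λ_1`, `a, b ∈ Λ_1` with `a + C ∈
(Λ_1/C)^{unit}`: `C + aΛ_2 = C + bΛ_2` iff `b ≡ av (mod C)` for some `v ∈ Λ_2` with `v + C ∈ (Λ_2/C)^{unit}`** — so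
(8.6) is a bijection from `(Λ_1/C)^{unit}/(Λ_2/C)^{unit}` onto the kernel (with §2 and g32-#5
`conductor_sup_map_mulLeft_mem_ker`). [cite: HertlingLarabi2026, §8 Thm. 8.2 (d) («(a+C) mod (Λ_2/C)^unit ↦ C + aΛ_2» is an isomorphism), chunks p0021–p0022]
[cite: NeukirchANT1999, I §12 Prop. (12.11) (one field: (𝒪_K/𝔣)^*/(𝒪/𝔣)^*), as identified by HertlingLarabi2026 Rem. 8.3] -/
theorem conductor_sup_map_mulLeft_eq_iff {Λ₁ Λ₂ : Submodule ℤ (Π i, L i)} (h1 : (1 : Π i, L i) ∈ Λ₁)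
    (hΛ₁Λ₁ : Λ₁ * Λ₁ ≤ Λ₁) (h2 : (1 : Π i, L i) ∈ Λ₂) (hΛ₂Λ₂ : Λ₂ * Λ₂ ≤ Λ₂) (hle : Λ₂ ≤ Λ₁)
    {a b : Π i, L i} (ha : a ∈ Λ₁) (hau : ∃ a' ∈ Λ₁, a * a' - 1 ∈ Λ₂ / Λ₁) :
    Λ₂ / Λ₁ ⊔ Λ₂.map (LinearMap.mulLeft ℤ a) = Λ₂ / Λ₁ ⊔ Λ₂.map (LinearMap.mulLeft ℤ b) ↔
      ∃ v ∈ Λ₂, (∃ v' ∈ Λ₂, v * v' - 1 ∈ Λ₂ / Λ₁) ∧ b - a * v ∈ Λ₂ / Λ₁ := by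
  have hΛ₁C : Λ₁ * (Λ₂ / Λ₁) = Λ₂ / Λ₁ :=
    le_antisymm (conductor_mul_le h1 hΛ₁Λ₁) fun y hy => by rw [← one_mul y]; exact Submodule.mul_mem_mul h1 hy
  have hCmul₁ : ∀ x ∈ Λ₁, ∀ c ∈ Λ₂ / Λ₁, x * c ∈ Λ₂ / Λ₁ := fun x hx c hc => by
    rw [← hΛ₁C]; exact Submodule.mul_mem_mul hx hc
  have hCmul : ∀ c ∈ Λ₂ / Λ₁, ∀ y ∈ Λ₂, c * y ∈ Λ₂ / Λ₁ := fun c hc y hy => by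
    rw [mul_comm]; exact hCmul₁ y (hle hy) c hc
  -- `b ≡ av (mod C)`, `v ∈ Λ₂` ⟹ `C + bΛ₂ ⊆ C + aΛ₂`
  have hincl : ∀ {a b v : Π i, L i}, v ∈ Λ₂ → b - a * v ∈ Λ₂ / Λ₁ →
      Λ₂ / Λ₁ ⊔ Λ₂.map (LinearMap.mulLeft ℤ b) ≤ Λ₂ / Λ₁ ⊔ Λ₂.map (LinearMap.mulLeft ℤ a) := by
    intro a b v hv hbav
    refine sup_le le_sup_left ?_
    rintro _ ⟨y, hy, rfl⟩
    have e : LinearMap.mulLeft ℤ b y = (b - a * v) * y + LinearMap.mulLeft ℤ a (v * y) := by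
      simp only [LinearMap.mulLeft_apply]; ring
    rw [e]
    exact Submodule.add_mem _ (Submodule.mem_sup_left (hCmul _ hbav y hy))
      (Submodule.mem_sup_right ⟨v * y, hΛ₂Λ₂ (Submodule.mul_mem_mul hv hy), rfl⟩)
  constructor
  · intro hN
    have hbN : b ∈ Λ₂ / Λ₁ ⊔ Λ₂.map (LinearMap.mulLeft ℤ a) := by
      rw [hN]; exact Submodule.mem_sup_right ⟨1, h2, by rw [LinearMap.mulLeft_apply, mul_one]⟩
    obtain ⟨c, hc, _, ⟨v, hv, rfl⟩, hcv⟩ := Submodule.mem_sup.1 hbN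
    have haN : a ∈ Λ₂ / Λ₁ ⊔ Λ₂.map (LinearMap.mulLeft ℤ b) := by
      rw [← hN]; exact Submodule.mem_sup_right ⟨1, h2, by rw [LinearMap.mulLeft_apply, mul_one]⟩
    obtain ⟨c', hc', _, ⟨v', hv', rfl⟩, hcv'⟩ := Submodule.mem_sup.1 haN
    rw [LinearMap.mulLeft_apply] at hcv hcv'
    refine ⟨v, hv, ⟨v', hv', ?_⟩, ?_⟩
    · -- `a(1 − vv') = c' + cv' ∈ C`, and `a` is a unit mod `C`
      obtain ⟨a', ha', haa'⟩ := hau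
      have h3 : a * (1 - v * v') ∈ Λ₂ / Λ₁ := by
        have e : a * (1 - v * v') = c' + c * v' := by linear_combination -hcv' - v' * hcv
        rw [e]
        exact Submodule.add_mem _ hc' (hCmul c hc v' hv')
      have e2 : v * v' - 1 = (a * a' - 1) * (1 - v * v') - a' * (a * (1 - v * v')) := by ring
      rw [e2]
      refine Submodule.sub_mem _ ?_ (hCmul₁ a' ha' _ h3)
      rw [mul_comm]
      exact hCmul₁ _ (Λ₁.sub_mem h1 (hΛ₁Λ₁ (Submodule.mul_mem_mul (hle hv) (hle hv')))) _ haa'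
    · have e : b - a * v = c := by linear_combination -hcv
      rw [e]; exact hc
  · rintro ⟨v, hv, ⟨v', hv', hvv'⟩, hbav⟩
    refine le_antisymm (hincl hv' ?_) (hincl hv hbav)
    -- `a − bv' = −a(vv' − 1) − (b − av)v' ∈ C`
    have e : a - b * v' = -(a * (v * v' - 1)) - (b - a * v) * v' := by ring
    rw [e]
    exact Submodule.sub_mem _ ((Λ₂ / Λ₁).neg_mem (hCmul₁ a ha _ hvv')) (hCmul _ hbav v' hv')

end ConductorKernel

end Literature.NumberTheory.ComplexMultiplication
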